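import Mathlib.GroupTheory.Schreier
import Mathlib.GroupTheory.Perm.Cycle.Type
import Mathlib.Data.Nat.Factorization.Basic
import Literature.GroupTheory.ProP.ProPFrattiniOpen
import Literature.GroupTheory.ProPPowerMap
import HarnessLib

/-!
# Serre's theorem: in a topologically finitely generated pro-`p` group every subgroup of finite index is open

J.-P. Serre, *Galois Cohomology*, I §4.2, exercise 6; J. D. Dixon, M. P. F. du Sautoy, A. Mann, D. Segal,
*Analytic pro-`p` groups* (2nd ed.), Theorem 1.17: "Let `G` be a finitely generated pro-`p` group. Then
every subgroup of finite index in `G` is open."  (The special, classical case of the theorem of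
Nikolov–Segal for all topologically finitely generated profinite groups.)

Setting: `G` a profinite group (compact, totally disconnected topological group) which is pro-`p`
(`hP`: every continuous finite quotient `G/U`, `U` open normal, is a `p`-group) and topologically
finitely generated (`ha`: some `a₁, …, a_d` generate a dense subgroup).  Contents (all proved):

* inputs consumed BY NAME from `Literature/GroupTheory/ProPPowerMap.lean` (abc-iut-w5-d218, same
  night, parallel seat): every ABSTRACT finite quotient of a pro-`p` group is a `p`-group
  (`isPGroup_quotient_of_finiteIndex_of_proP`, via surjectivity of coprime power maps), and subgroups
  of pro-`p` groups are pro-`p` (`isPGroup_quotient_openNormalSubgroup_subgroup`);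
* `exists_topologicalGenerators_of_isOpen` — an open subgroup of a topologically finitely generated
  compact group is again topologically finitely generated (Schreier: Mathlib
  `Subgroup.fg_of_index_ne_zero`, and density of the trace of a dense subgroup on an open subgroup);
* `isOpen_of_finiteIndex` — **Serre's theorem**, by induction on the `p`-power index: a nontrivial
  finite `p`-group has a proper subgroup containing all `p`-th powers and commutators, whose preimage is
  open by Serre's lemma (`ProPFrattiniOpen.lean`) and is again a topologically finitely generated
  pro-`p` group;
* `continuous_of_monoidHom_to_finite` — every homomorphism to a finite (discrete) group is continuous.

Proof-only (no definitions).
[cite: DixonDuSautoyMannSegal1999, Ch. 1 Thm. 1.17] [cite: SerreGaloisCohomology1997, I §4.2 ex. 6]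
-/

namespace Literature.GroupTheory.ProP

open Subgroup Topology
open scoped commutatorElement Pointwise

universe u v

variable {G : Type u} [Group G] [TopologicalSpace G] [IsTopologicalGroup G] [CompactSpace G]
  [TotallyDisconnectedSpace G]

/-! ### Open subgroups: pro-`p` and topologically finitely generated -/

omit [IsTopologicalGroup G] [CompactSpace G] [TotallyDisconnectedSpace G] in
/-- The image in `G` of an open subgroup of an open subgroup `M ≤ G` is open.
[cite: DixonDuSautoyMannSegal1999, Ch. 1 Prop. 1.2] -/
theorem isOpen_map_subtype_of_isOpen {M : Subgroup G} (hM : IsOpen (M : Set G))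
    {V : Subgroup M} (hV : IsOpen (V : Set M)) : IsOpen ((V.map M.subtype : Subgroup G) : Set G) := by
  rw [Subgroup.coe_map]
  exact hM.isOpenMap_subtype_val _ hV

omit [TotallyDisconnectedSpace G] in
/-- **An open subgroup of a topologically finitely generated compact group is topologically finitely
generated** (Schreier's lemma for the dense finitely generated subgroup, whose trace on the open
subgroup is dense in it). [cite: DixonDuSautoyMannSegal1999, Ch. 1 Prop. 1.7] -/
theorem exists_topologicalGenerators_of_isOpen {d : ℕ} {a : Fin d → G}
    (ha : (Subgroup.closure (Set.range a)).topologicalClosure = ⊤)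
    {M : Subgroup G} (hM : IsOpen (M : Set G)) :
    ∃ (d' : ℕ) (b : Fin d' → M), (Subgroup.closure (Set.range b)).topologicalClosure = ⊤ := by
  classical
  set Γ : Subgroup G := Subgroup.closure (Set.range a) with hΓ
  haveI : Group.FG Γ := Group.closure_finite_fg _
  haveI : Finite (G ⧸ M) := Subgroup.quotient_finite_of_isOpen M hM
  haveI : M.FiniteIndex := Subgroup.finiteIndex_of_finite_quotient
  -- the trace `L = Γ ∩ M`, a finite-index subgroup of the finitely generated group `Γ`
  set L : Subgroup Γ := M.subgroupOf Γ with hL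
  haveI : Group.FG L := Subgroup.fg_of_index_ne_zero L
  obtain ⟨-, T, -, hT⟩ := Group.fg_iff'.mp (inferInstance : Group.FG L)
  -- transport the finite generating set of `L` into `M`
  let ι : L → M := fun t => ⟨((t : Γ) : G), Subgroup.mem_subgroupOf.mp t.2⟩
  refine ⟨T.card, fun i => ι (T.equivFin.symm i), ?_⟩
  set B : Subgroup M := Subgroup.closure (Set.range fun i => ι (T.equivFin.symm i)) with hB
  -- `B` maps onto `Γ ∩ M` in `G`
  have hBmap : (M ⊓ Γ : Subgroup G) ≤ B.map M.subtype := by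
    intro x hx
    have hxL : (⟨x, hx.2⟩ : Γ) ∈ L := Subgroup.mem_subgroupOf.mpr hx.1
    -- `⟨x⟩ ∈ L = closure T`
    have hmem : (⟨⟨x, hx.2⟩, hxL⟩ : L) ∈ Subgroup.closure (T : Set L) := by rw [hT]; trivial
    -- push through the homomorphism `L → M`, `t ↦ ι t`
    let ιh : L →* M :=
      { toFun := ι
        map_one' := rfl
        map_mul' := fun _ _ => rfl }
    have himg : ιh '' (T : Set L) ⊆ Set.range fun i => ι (T.equivFin.symm i) := by
      rintro _ ⟨t, ht, rfl⟩
      exact ⟨T.equivFin ⟨t, ht⟩, by simp [ιh]⟩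
    have hBx : ιh ⟨⟨x, hx.2⟩, hxL⟩ ∈ B := by
      have := Subgroup.mem_map_of_mem ιh hmem
      rw [MonoidHom.map_closure] at this
      exact Subgroup.closure_mono himg this
    exact ⟨_, hBx, rfl⟩
  -- density in `M`: `M ∩ closure Γ ⊆ closure (M ∩ Γ)`
  rw [eq_top_iff]
  rintro ⟨x, hxM⟩ -
  rw [← SetLike.mem_coe, Subgroup.topologicalClosure_coe,
    Topology.IsInducing.subtypeVal.closure_eq_preimage_closure_image, Set.mem_preimage]
  have hΓdense : _root_.closure (Γ : Set G) = Set.univ := by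
    rw [← Subgroup.topologicalClosure_coe, hΓ, ha, Subgroup.coe_top]
  have hx : x ∈ _root_.closure ((M : Set G) ∩ Γ) := hM.inter_closure ⟨hxM, by rw [hΓdense]; trivial⟩
  refine closure_mono ?_ hx
  intro y hy
  obtain ⟨z, hz, rfl⟩ := hBmap hy
  exact ⟨z, hz, rfl⟩

/-! ### Serre's theorem -/

/-- A nontrivial finite `p`-group has a PROPER subgroup containing all `p`-th powers and all commutators
(its Frattini subgroup): the abelianization is a nontrivial finite abelian `p`-group, on which the
`p`-th power map is not surjective. [cite: DixonDuSautoyMannSegal1999, Ch. 1 Prop. 1.16] -/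
theorem exists_lt_top_forall_pow_mem {F : Type v} [Group F] [Finite F] [Nontrivial F] {p : ℕ}
    [Fact p.Prime] (hF : IsPGroup p F) :
    ∃ K : Subgroup F, K ≠ ⊤ ∧ (∀ x : F, x ^ p ∈ K) ∧ ∀ x y : F, ⁅x, y⁆ ∈ K := by
  classical
  haveI : Group.IsNilpotent F := hF.isNilpotent
  -- the abelianization is nontrivial
  have hcomm : commutator F ≠ ⊤ := by
    intro htop
    have hall : ∀ n, (⊤ : Subgroup F).lowerCentralSeries n = ⊤ := by
      intro n
      induction n with
      | zero => rfl
      | succ n ih => rw [Subgroup.lowerCentralSeries_succ, ih]; exact htop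
    have h := Subgroup.lowerCentralSeries_nilpotencyClass (G := F)
    rw [hall] at h
    exact top_ne_bot h
  obtain ⟨x₀, -, hx₀⟩ := SetLike.exists_of_lt (lt_top_iff_ne_top.mpr hcomm)
  let A := Abelianization F
  let ab : F →* A := Abelianization.of
  have hab1 : ab x₀ ≠ 1 := fun h => hx₀ (by
    rw [← Abelianization.ker_of (G := F), MonoidHom.mem_ker]; exact h)
  haveI : Nontrivial A := ⟨⟨ab x₀, 1, hab1⟩⟩
  haveI : Finite A := Finite.of_surjective ab QuotientGroup.mk_surjective
  have hA : IsPGroup p A := hF.of_surjective ab QuotientGroup.mk_surjective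
  -- on a nontrivial finite `p`-group the `p`-th power map is not injective, hence not surjective
  have hns : ¬ Function.Surjective fun x : A => x ^ p := by
    intro hs
    have hi : Function.Injective fun x : A => x ^ p := Finite.injective_iff_surjective.mpr hs
    obtain ⟨k, hk⟩ := IsPGroup.iff_card.mp hA
    have hk0 : k ≠ 0 := by
      rintro rfl
      rw [pow_zero] at hk
      exact (Finite.one_lt_card_iff_nontrivial.mpr ‹Nontrivial A›).ne' hk
    have hdvd : p ∣ Nat.card A := by rw [hk]; exact dvd_pow_self p hk0
    obtain ⟨z, hz⟩ := exists_prime_orderOf_dvd_card' p hdvd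
    have hz1 : z ≠ 1 := by
      intro h
      rw [h, orderOf_one] at hz
      exact (Fact.out : p.Prime).one_lt.ne' hz.symm
    refine hz1 (hi ?_)
    simp only [one_pow, ← hz, pow_orderOf_eq_one]
  obtain ⟨c, hc'⟩ := not_forall.mp hns
  have hc : ∀ y : A, y ^ p ≠ c := fun y hy => hc' ⟨y, hy⟩
  refine ⟨((powMonoidHom p : A →* A).range).comap ab, ?_, fun x => ?_, fun x y => ?_⟩
  · intro htop
    obtain ⟨y, hy⟩ := QuotientGroup.mk_surjective c
    have hy' : (y : F) ∈ ((powMonoidHom p : A →* A).range).comap ab := by rw [htop]; trivial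
    obtain ⟨w, hw⟩ := Subgroup.mem_comap.mp hy'
    rw [powMonoidHom_apply] at hw
    exact hc w (hw.trans hy)
  · exact Subgroup.mem_comap.mpr ⟨ab x, by rw [powMonoidHom_apply, map_pow]⟩
  · refine Subgroup.mem_comap.mpr ⟨1, ?_⟩
    rw [powMonoidHom_apply, one_pow, map_commutatorElement, eq_comm, commutatorElement_eq_one_iff_commute]
    exact Commute.all _ _

omit [TopologicalSpace G] [IsTopologicalGroup G] [CompactSpace G] [TotallyDisconnectedSpace G] in
/-- Normality of `N` inside `M` passes to intermediate subgroups `N ≤ H ≤ M`.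
[cite: DixonDuSautoyMannSegal1999, Ch. 1 Thm. 1.17] -/
theorem normal_subgroupOf_of_le {N H M : Subgroup G} (hHM : H ≤ M) (hN : (N.subgroupOf M).Normal) :
    (N.subgroupOf H).Normal := by
  refine ⟨fun x hx h => ?_⟩
  have := hN.conj_mem ⟨(x : G), hHM x.2⟩ (Subgroup.mem_subgroupOf.mpr (Subgroup.mem_subgroupOf.mp hx))
    ⟨(h : G), hHM h.2⟩
  simpa only [Subgroup.mem_subgroupOf, Subgroup.coe_mul, Subgroup.coe_inv] using this

/-- **Serre's theorem** (Dixon–du Sautoy–Mann–Segal, *Analytic pro-`p` groups*, Thm. 1.17): in a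
topologically finitely generated pro-`p` group, every subgroup of finite index is open.
[cite: DixonDuSautoyMannSegal1999, Ch. 1 Thm. 1.17] [cite: SerreGaloisCohomology1997, I §4.2 ex. 6] -/
theorem isOpen_of_finiteIndex {p : ℕ} [Fact p.Prime]
    (hP : ∀ U : OpenNormalSubgroup G, IsPGroup p (G ⧸ U.toSubgroup))
    {d : ℕ} {a : Fin d → G} (ha : (Subgroup.closure (Set.range a)).topologicalClosure = ⊤)
    (H : Subgroup G) [H.FiniteIndex] : IsOpen (H : Set G) := by
  classical
  have hp : p.Prime := Fact.out
  -- KEY CLAIM, by strong induction on the exponent `n` of the index: for `M ≤ G` open and `N ≤ M`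
  -- normal in `M` with `[M : N] = p ^ n`, the subgroup `N` is open.
  suffices key : ∀ (n : ℕ) (M N : Subgroup G), IsOpen (M : Set G) → N ≤ M →
      (N.subgroupOf M).Normal → N.relIndex M = p ^ n → IsOpen (N : Set G) by
    let N := H.normalCore
    obtain ⟨n, hn⟩ := IsPGroup.iff_card.mp (Literature.GroupTheory.isPGroup_quotient_of_finiteIndex_of_proP hP N)
    refine Subgroup.isOpen_mono (Subgroup.normalCore_le H) (key n ⊤ N ?_ le_top inferInstance ?_)
    · rw [Subgroup.coe_top]; exact isOpen_univ
    · rw [Subgroup.relIndex_top_right]; exact hn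
  intro n
  induction n using Nat.strong_induction_on with
  | _ n ih =>
  intro M N hMo hNM hNn hidx
  rcases Nat.eq_zero_or_pos n with rfl | hnpos
  · rw [pow_zero, Subgroup.relIndex_eq_one] at hidx
    rw [le_antisymm hNM hidx]
    exact hMo
  -- `n ≥ 1`: pass to the compact open subgroup `M`, again pro-`p` and topologically finitely generated
  haveI : CompactSpace M := isCompact_iff_compactSpace.mp (M.isClosed_of_isOpen hMo).isCompact
  have hPM : ∀ V : OpenNormalSubgroup M, IsPGroup p (M ⧸ V.toSubgroup) := fun V =>
    Literature.GroupTheory.isPGroup_quotient_openNormalSubgroup_subgroup hP M V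
  obtain ⟨d', b, hb⟩ := exists_topologicalGenerators_of_isOpen ha hMo
  -- the nontrivial finite `p`-group `M ⧸ N`
  set N' : Subgroup M := N.subgroupOf M with hN'
  haveI : N'.Normal := hNn
  have hidx' : Nat.card (M ⧸ N') = p ^ n := hidx
  haveI : N'.FiniteIndex := ⟨by rw [Subgroup.index, hidx']; exact pow_ne_zero _ hp.ne_zero⟩
  haveI : Finite (M ⧸ N') := Subgroup.finite_quotient_of_finiteIndex
  have hF : IsPGroup p (M ⧸ N') := IsPGroup.of_card hidx'
  haveI : Nontrivial (M ⧸ N') := Finite.one_lt_card_iff_nontrivial.mp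
    (by rw [hidx']; exact Nat.one_lt_pow hnpos.ne' hp.one_lt)
  obtain ⟨K, hKtop, hKpow, hKcomm⟩ := exists_lt_top_forall_pow_mem hF
  -- the preimage `H₁ ≤ M` of the proper Frattini-type subgroup `K` is open in `M` by Serre's lemma
  set H₁ : Subgroup M := K.comap (QuotientGroup.mk' N') with hH₁
  have hH₁o : IsOpen (H₁ : Set M) :=
    isOpen_of_forall_pow_mem_of_forall_commutator_mem (p := p) hPM hb H₁
      (fun x => Subgroup.mem_comap.mpr (by rw [map_pow]; exact hKpow _))
      (fun x y => Subgroup.mem_comap.mpr (by rw [map_commutatorElement]; exact hKcomm _ _))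
  -- its image `H₂` in `G`: open, `N ≤ H₂ ≤ M`, `H₂ ≠ M`
  set H₂ : Subgroup G := H₁.map M.subtype with hH₂
  have hH₂o : IsOpen (H₂ : Set G) := isOpen_map_subtype_of_isOpen hMo hH₁o
  have hH₂M : H₂ ≤ M := Subgroup.map_subtype_le _
  have hNH₂ : N ≤ H₂ := by
    intro x hx
    refine ⟨⟨x, hNM hx⟩, Subgroup.mem_comap.mpr ?_, rfl⟩
    have h1 : (QuotientGroup.mk' N') ⟨x, hNM hx⟩ = 1 :=
      (QuotientGroup.eq_one_iff _).mpr (Subgroup.mem_subgroupOf.mpr hx)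
    rw [h1]; exact K.one_mem
  have hMH₂ : ¬ M ≤ H₂ := by
    intro hle
    apply hKtop
    rw [eq_top_iff]
    rintro q -
    obtain ⟨m, rfl⟩ := QuotientGroup.mk_surjective q
    obtain ⟨m', hm', hmm'⟩ := hle m.2
    have : m' = m := Subtype.ext hmm'
    rw [this] at hm'
    exact Subgroup.mem_comap.mp hm'
  -- `[H₂ : N] = p ^ k` with `k < n`, and `N` is normal in `H₂`: induction hypothesis
  have hmul := Subgroup.relIndex_mul_relIndex N H₂ M hNH₂ hH₂M
  rw [hidx] at hmul
  obtain ⟨k, hk, hkeq⟩ := (Nat.dvd_prime_pow hp).mp (Dvd.intro _ hmul)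
  have hklt : k < n := by
    rcases hk.lt_or_eq with h | heq
    · exact h
    · exfalso
      rw [hkeq, heq] at hmul
      have h1 : H₂.relIndex M = 1 :=
        mul_right_injective₀ (pow_ne_zero n hp.ne_zero) (hmul.trans (mul_one _).symm)
      exact hMH₂ (Subgroup.relIndex_eq_one.mp h1)
  exact ih k hklt H₂ N hH₂o hNH₂ (normal_subgroupOf_of_le hH₂M hNn) hkeq

/-- **Every homomorphism from a topologically finitely generated pro-`p` group to a finite group has
open kernel** (hence is continuous for the discrete topology, "strong completeness" of finitely generated
pro-`p` groups). [cite: DixonDuSautoyMannSegal1999, Ch. 1 Thm. 1.17] -/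
theorem isOpen_ker_of_finite {p : ℕ} [Fact p.Prime]
    (hP : ∀ U : OpenNormalSubgroup G, IsPGroup p (G ⧸ U.toSubgroup))
    {d : ℕ} {a : Fin d → G} (ha : (Subgroup.closure (Set.range a)).topologicalClosure = ⊤)
    {F : Type v} [Group F] [Finite F] (f : G →* F) : IsOpen (f.ker : Set G) := by
  haveI : Finite (G ⧸ f.ker) := Finite.of_injective _ (QuotientGroup.kerLift_injective f)
  haveI : f.ker.FiniteIndex := Subgroup.finiteIndex_of_finite_quotient
  exact isOpen_of_finiteIndex hP ha f.ker

end Literature.GroupTheory.ProP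

-- (build enqueue re-land 2026-08-26T08:31Z: tree bytes unchanged above; stranded-accept self-remedy, no content change)
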